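/-
Copyright (c) 2026. All rights reserved.
Released under Apache 2.0 license as described in the file LICENSE.
Authors: abc-iut cell, seat abc-iut-L4-t10 (gen 3; interface author of `AutHolFieldFunctor`; assembly of the
three id-rigidity instances of the geometric `EA`).
-/
import Literature.AnabelianGeometry.AbsoluteAnabelian.ArchimedeanHolFieldFunctorGeometricPuncturedPlane
import Literature.AnabelianGeometry.AbsoluteAnabelian.ArchimedeanHolFieldFunctorGeometricDiscProofs
import HarnessLib

/-!
# [AbsTopIII] Prop 4.2 (i) / Cor 4.5 at the holomorphic geometric model: `EA` over any family of the three
# carriers `ℂ`, `ℂ^×`, `𝔻` is id-rigid; Cor 4.5 there outright (assembly)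

S. Mochizuki, *Topics in absolute anabelian geometry III*, Prop 4.2 (i) p. 105 ("the categories `EA`,
`𝒞^hol_T = 𝒞̲^hol_T` … are id-rigid"), Cor 4.5 (i)–(v) pp. 107–110, Def 2.1 (i) p. 50; kurims manuscript
(lit key `paper:url-5493eb38cbb7`, read on the page; bib key `MochizukiAbsTopIII2015`).  PROOF-ONLY
assembly (abc-iut cell, nodes `AbsTopIII:Prop4.2(i)`, `AbsTopIII:Cor4.5`; no declaration of a notion) of

* `ArchimedeanHolFieldFunctorGeometricPlaneProofs` / `…PuncturedPlane` (abc-iut-L4-t10): the component of an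
  automorphism of `𝟭_{EA^hol_RS(Q)}` at an object with underlying surface `ℂ` (translations + a dilation)
  or `ℂ^×` (dilations + the non-invertible squaring map) is the identity, for ANY `Q`;
* `ArchimedeanHolFieldFunctorGeometricDiscProofs` (abc-iut-L4-t14): the same at the Aut-holomorphic disc `𝔻`
  (the rotation `z ↦ -z` + the Möbius involutions), for ANY `Q` — `HolRS.app_eq_id_of_obj_eq_disc`.

Hence, with no further analysis:

* `HolRS.isIdRigid_EA_of_subset_carriers` — **`EA^hol_RS(Q)` is id-rigid for every object property `Q` all
  of whose objects are among `ℂ`, `ℂ^×`, `𝔻`** (the universal coverings of all Riemann surfaces — `ℂ` for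
  genus one, `𝔻` for the hyperbolic ones, Cor 2.4 — together with the cyclic quotient `ℂ^×`);
* `HolRS.isIdRigid_EA_carriers` — the instance `Q = {ℂ, ℂ^×, 𝔻}`;
* `HolRS.cor_4_5_geometric_of_subset_carriers`, **`HolRS.cor_4_5_geometric_carriers`**,
  `HolRS.isIdRigid_pairs_carriers` — Cor 4.5 (i)–(v) AS TYPED and Prop 4.2 (i)'s id-rigidity of `𝒞^hol_TF`,
  `𝒞^hol_T` (`T ∈ {TM, TLG, TCG}`) OUTRIGHT for the archimedean log-Frobenius data over these carriers
  (abc-iut-L4-t14's `cor_4_5_geometric` / `isIdRigid_pairs_of_isIdRigid_EA`, hypothesis discharged).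

HONEST SCOPE (unchanged): none of `ℂ`, `ℂ^×`, `𝔻` is an elliptically admissible hyperbolic orbicurve over a
CAF (print's `EA`: `𝔻` is hyperbolic but not algebraic, `ℂ`, `ℂ^×` are not hyperbolic); for such `Q` the
id-rigidity is Lemma 4.3's slimness via Cor 2.3 (i) and Riemann existence (campaign-L; the printed route is
realised at the Galois-category instance `AutHolFieldFunctor.ofGaloisCategory`).  Refereed pre-IUT
anabelian geometry; nothing here bears on [IUTchIII] Cor. 3.12 or takes a side; model ≠ reconstruction.
-/

set_option autoImplicit false

noncomputable section

namespace Literature.AnabelianGeometry.AbsoluteAnabelian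

open _root_.CategoryTheory

namespace HolRS

variable (Q : ObjectProperty HolRS)

/-- **`EA^hol_RS(Q)` is id-rigid whenever every object of `Q` is the plane, the punctured plane or the
disc** (Prop 4.2 (i) "the categor[y] `EA` … [is] id-rigid", PROVED at these geometric carriers: the three
`Q`-generic component lemmas). [cite: MochizukiAbsTopIII2015, Proposition 4.2 (i) p.105] -/
theorem isIdRigid_EA_of_subset_carriers
    (hQ : ∀ X : HolRS, Q X → X = complexPlane ∨ X = puncturedPlane ∨ X = disc) :
    IsIdRigid (geometricAutHolFieldFunctor Q).EA := by
  refine isRigidFunctor_of_hom_app_eq_id fun α P => ?_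
  rcases hQ P.obj P.property with h | h | h
  · exact app_eq_id_of_obj_eq_plane Q α P h
  · exact app_eq_id_of_obj_eq_puncturedPlane Q α P h
  · exact app_eq_id_of_obj_eq_disc Q α P h

/-- **Cor 4.5 (i)–(v) AS TYPED, OUTRIGHT, over any family of geometric carriers drawn from
`{ℂ, ℂ^×, 𝔻}`** containing an object. [cite: MochizukiAbsTopIII2015, Corollary 4.5 pp.107–109] -/
theorem cor_4_5_geometric_of_subset_carriers
    (hQ : ∀ X : HolRS, Q X → X = complexPlane ∨ X = puncturedPlane ∨ X = disc)
    (X₀ : (geometricAutHolFieldFunctor Q).EA) :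
    Literature.AnabelianGeometry.AbsoluteAnabelian.AbsTopIII.Cor_4_5
      (archLogFrobeniusData (geometricAutHolFieldFunctor Q)) (archTelecoreData (geometricAutHolFieldFunctor Q)) :=
  cor_4_5_geometric Q X₀ (isIdRigid_EA_of_subset_carriers Q hQ)

/-- **Prop 4.2 (i), id-rigidity of `𝒞^hol_TF` and `𝒞^hol_T`, OUTRIGHT, over any family drawn from
`{ℂ, ℂ^×, 𝔻}`.** [cite: MochizukiAbsTopIII2015, Proposition 4.2 (i) p.105] -/
theorem isIdRigid_pairs_of_subset_carriers
    (hQ : ∀ X : HolRS, Q X → X = complexPlane ∨ X = puncturedPlane ∨ X = disc)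
    {T : ArchPairType} (hT : T.IsMonoidType) :
    IsIdRigid (HolTFPair (geometricAutHolFieldFunctor Q)) ∧
      IsIdRigid (HolMonoidPair (geometricAutHolFieldFunctor Q) T) :=
  isIdRigid_pairs_of_isIdRigid_EA Q (isIdRigid_EA_of_subset_carriers Q hQ) hT

/-! ### The instance `Q = {ℂ, ℂ^×, 𝔻}` -/

/-- **`EA^hol_RS` on the three carriers `ℂ`, `ℂ^×`, `𝔻` is id-rigid.**
[cite: MochizukiAbsTopIII2015, Proposition 4.2 (i) p.105] -/
theorem isIdRigid_EA_carriers :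
    IsIdRigid (geometricAutHolFieldFunctor
      (fun X : HolRS => X = complexPlane ∨ X = puncturedPlane ∨ X = disc)).EA :=
  isIdRigid_EA_of_subset_carriers _ (fun _ h => h)

/-- **Prop 4.2 (i), id-rigidity of `𝒞^hol_TF` and `𝒞^hol_T`, OUTRIGHT over `{ℂ, ℂ^×, 𝔻}`.**
[cite: MochizukiAbsTopIII2015, Proposition 4.2 (i) p.105] -/
theorem isIdRigid_pairs_carriers {T : ArchPairType} (hT : T.IsMonoidType) :
    IsIdRigid (HolTFPair (geometricAutHolFieldFunctor
        (fun X : HolRS => X = complexPlane ∨ X = puncturedPlane ∨ X = disc))) ∧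
      IsIdRigid (HolMonoidPair (geometricAutHolFieldFunctor
        (fun X : HolRS => X = complexPlane ∨ X = puncturedPlane ∨ X = disc)) T) :=
  isIdRigid_pairs_of_subset_carriers _ (fun _ h => h) hT

/-- **[AbsTopIII] Cor 4.5 (i)–(v) AS TYPED hold OUTRIGHT for the archimedean log-Frobenius data over the
geometric carriers `{ℂ, ℂ^×, 𝔻}`.** [cite: MochizukiAbsTopIII2015, Corollary 4.5 pp.107–109] -/
theorem cor_4_5_geometric_carriers :
    Literature.AnabelianGeometry.AbsoluteAnabelian.AbsTopIII.Cor_4_5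
      (archLogFrobeniusData (geometricAutHolFieldFunctor
        (fun X : HolRS => X = complexPlane ∨ X = puncturedPlane ∨ X = disc)))
      (archTelecoreData (geometricAutHolFieldFunctor
        (fun X : HolRS => X = complexPlane ∨ X = puncturedPlane ∨ X = disc))) :=
  cor_4_5_geometric_of_subset_carriers _ (fun _ h => h) ⟨disc, Or.inr (Or.inr rfl)⟩

end HolRS

end Literature.AnabelianGeometry.AbsoluteAnabelian

end
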